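import Summits.BirchSwinnertonDyer.BirchSwinnertonDyer.Theorems.ThetaPartnerAtTwoMazurTateCongruenceAtTwoRIharaSymbolModTwo
import Summits.BirchSwinnertonDyer.BirchSwinnertonDyer.Theorems.ThetaPartnerAtTwoMazurTateCongruenceAtTwoRNotEisensteinAtTwo
import Summits.BirchSwinnertonDyer.Rank1Residual.P2.EmptyCellsAtTwo
import HarnessLib

/-!
# Crux `MazurTateCongruenceAtTwoTop` (stmt-BirchSwinnertonDyer-25797 = `MazurTateCongruenceAtTwoR` 21416), line `symbol` v5:
# the registered stub `stub_iharaSymbolModTwoNegDisc` — (IH₂⁻) «Ihara's lemma mod `2` in symbol form, `S₃`-image case» — PROVED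
# (width seat bsd-wall-tp2-p1-w3 g0; `--supports stmt-BirchSwinnertonDyer-25797`; stub BY NAME)

HONEST FRAMING. THEOREM ONLY (no `def`, no named fact, no `sorry`); nothing about BSD is asserted. This closes the one load-bearing
non-PUB stub of skeleton `symbol` v5 (lead tp2-p1 g11); the crux then rests on the two cite-only PUB stubs through the lead's
composition `MazurTateCongruenceAtTwoTop_of` — BSD is not proved by any of this.

PROOF = three landed pieces: `iharaSymbolModTwo_of_notEisenstein` (this seat, `…RIharaSymbolModTwo`: reduction mod `𝔪`, the
`SL₂(ℤ[1/ℓ])` identity turning `ℤ[1/ℓ]`-translation invariance into `ℓ^{2k}`-dilation invariance, and `eq_zero_of_dilationInvariant` =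
Ihara for symbol functions via cell bsd-f2-manin's `relativeIharaShiftVanishingBar_holds`), the non-Eisenstein input
`not_isEisensteinEigensystem_two_of_Δ_neg` (tp2-p1-w2 g3, `…RNotEisensteinAtTwo`: `W[2]` irreducible with `Δ_W < 0` ⟹ `a_q(W) mod 2` is
not weight-`2` Eisenstein over any field of characteristic `2`), and `P2.irr_two_of_goodSS_two` (good supersingular at `2` ⟹ `W[2]`
irreducible).

References: K. Ribet, Proc. ICM 1983 (1984) Thm. 4.1/4.3; J.-P. Serre, Ann. of Math. 92 (1970) Thm. 2; R. Greenberg, V. Vatsal,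
Invent. Math. 142 (2000) §3.
-/

-- justification: the `Summit.BirchSwinnertonDyer.BirchSwinnertonDyer.…` path repeats a component (route-file convention)
set_option linter.dupNamespace false
set_option autoImplicit false

noncomputable section

open scoped MatrixGroups

open CongruenceSubgroup Literature.NumberTheory.EllipticCurves Literature.NumberTheory.EllipticCurves.ModularForms
  Literature.NumberTheory.EllipticCurves.Rank1Residual

namespace Summit.BirchSwinnertonDyer.BirchSwinnertonDyer.Theorems.MazurTateCongruenceAtTwoR

/-- **`stub_iharaSymbolModTwoNegDisc` (skeleton `symbol` v5 of crux 25797), PROVED — (IH₂⁻) «Ihara's lemma mod `2` in symbol form».**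
For `W` good supersingular at `2` with `Δ_W < 0`, an odd `N'`, an odd prime `ℓ` and an integral `Γ₀(N')`-symbol function `Φ : ℚ → ℚ̄₂`
Hecke-congruent to `a_q(W)` off `2N'ℓ`: if `Φ` is `ℤ[1/ℓ]`-translation invariant modulo `𝔪` then `Φ ≡ 0 (mod 𝔪)`. Registered signature
verbatim; proof = `iharaSymbolModTwo_of_notEisenstein` + `not_isEisensteinEigensystem_two_of_Δ_neg` + `P2.irr_two_of_goodSS_two`.
[cite: Ribet1984ICM, Thm. 4.1 and Thm. 4.3 (shape)] [cite: GreenbergVatsal2000, §3 (un-depletion via Ihara; p odd there)] -/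
theorem stub_iharaSymbolModTwoNegDisc :
    ∀ (W : WeierstrassCurve ℚ) [W.IsElliptic] [W.IsGloballyMinimal], GoodSS W 2 → W.Δ < 0 → ∀ (N' : ℕ), Odd N' → (∀ v : IsDedekindDomain.HeightOneSpectrum (NumberField.RingOfIntegers ℚ), ¬ ((Rat.HeightOneSpectrum.primesEquiv v : ℕ) ∣ 2 * N') → W.HasGoodReductionAt v) → ∀ (ℓ : ℕ), ℓ.Prime → ℓ ≠ 2 → ∀ (Φ : ℚ → PadicAlgCl 2), (∀ (r : ℚ) (z : ℤ), Φ (r + z) = Φ r) → (∀ r : ℚ, Φ (-r) = Φ r) → (∀ (γ : CongruenceSubgroup.Gamma0 (N')) (r : ℚ), ((γ : SL(2, ℤ)) 1 0 : ℚ) * r + ((γ : SL(2, ℤ)) 1 1 : ℚ) ≠ 0 → Φ ((((γ : SL(2, ℤ)) 0 0 : ℚ) * r + ((γ : SL(2, ℤ)) 0 1 : ℚ)) / (((γ : SL(2, ℤ)) 1 0 : ℚ) * r + ((γ : SL(2, ℤ)) 1 1 : ℚ))) = (if ((γ : SL(2, ℤ)) 1 0) = 0 then 0 else Φ ((((γ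 : SL(2, ℤ)) 0 0 : ℚ)) / (((γ : SL(2, ℤ)) 1 0 : ℚ)))) + Φ r) → (∀ r : ℚ, ‖Φ r‖ ≤ 1) → (∀ q : ℕ, q.Prime → ¬ q ∣ 2 * N' * ℓ → ∀ r : ℚ, ‖(∑ j : Fin q, Φ ((r + j) / q)) + Φ (q * r) - (W.LFunction q : PadicAlgCl 2) * Φ r‖ < 1) → (∀ (r : ℚ) (j : ℤ) (n : ℕ), ‖Φ (r + j / (ℓ : ℚ) ^ n) - Φ r‖ < 1) → ∀ r : ℚ, ‖Φ r‖ < 1 := by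
  intro W _ _ hss hΔ N' hN' hgood ℓ hℓ hℓ2 Φ hper hev hΦ hle hT htr
  exact iharaSymbolModTwo_of_notEisenstein W hss
    (fun F _ _ ↦ not_isEisensteinEigensystem_two_of_Δ_neg W
      (Summit.BirchSwinnertonDyer.Rank1Residual.P2.irr_two_of_goodSS_two W hss) hΔ F)
    N' hN' hgood ℓ hℓ hℓ2 Φ hper hev hΦ hle hT htr

end Summit.BirchSwinnertonDyer.BirchSwinnertonDyer.Theorems.MazurTateCongruenceAtTwoR

end
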